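import Literature.Probability.LatticeModels.PointwiseScalingLimitEtaExists
import Literature.Probability.LatticeModels.HighDimPointwiseTriviality
import HarnessLib

/-!
# S3 of line `Sketch` of crux `SubPtolemyFloor` (item stmt-CriticalPhenomena-15703, route
# `SubPtolemyInterlacing`): block pair sum ⇒ box susceptibility

THEOREM-ONLY file (no definitions, no named facts). Write `G = criticalTwoPoint 3` for the critical
two-point function `⟨σ₀σ_x⟩⁺_{β_c}` of the nearest-neighbour Ising model on `ℤ³`, `Λ_n = box 3 n`,
`χ_n = Σ_{x ∈ Λ_n} G(x)` (box susceptibility) and `B_n = Σ_{a,b ∈ Λ_n} G(b - a)` (the block-spin second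
moment `⟨M_n²⟩`).

**Theorem** (`stub_susceptibilityFloorOfBoxPairFloor`). If `B_n ≥ c n^s` for all `n ≥ 1` with `s ≥ 3`
and `c > 0`, then `χ_N ≥ c' N^{3-(6-s)} = c' N^{s-3}` for all `N ≥ 1` with some `c' > 0`.

**Proof.** For `a, b ∈ Λ_n`, `b - a ∈ Λ_{2n}`; since `G ≥ 0` (Griffiths) and `b ↦ b - a` is injective,
`Σ_{b ∈ Λ_n} G(b - a) ≤ χ_{2n}` for each `a`, so `B_n ≤ |Λ_n| χ_{2n} = (2n+1)³ χ_{2n} ≤ 27 n³ χ_{2n}`.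
For `N ≥ 2` put `n = ⌊N/2⌋ ≥ 1`: `2n ≤ N ≤ 3n`, and `χ` is monotone in the box (`G ≥ 0`), so
`c n^s ≤ 27 n³ χ_N`, i.e. `c n^{s-3} ≤ 27 χ_N`, and `N^{s-3} ≤ 3^{s-3} n^{s-3}`; hence
`χ_N ≥ c/(27·3^{s-3}) · N^{s-3}`. For `N = 1`, `χ_1 ≥ G(0) = 1`. The constant
`c' = min 1 (c/(27·3^{s-3}))` serves all `N ≥ 1`.

References: folklore bookkeeping; the inputs are `criticalTwoPoint_nonneg'`, `criticalTwoPoint_zero'`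
(Griffiths' first inequality, `⟨σ₀σ₀⟩ = 1`), `mem_box`, `card_box`, `box_mono` (Friedli–Velenik 2017,
§3.2).
-/

noncomputable section

namespace Summit.CriticalPhenomena.Ising3DConformalLimit.SubPtolemyFloorSketch

open scoped BigOperators Classical
open Finset Literature.Probability.LatticeModels

/-! ### Box bookkeeping -/

/-- Differences of two points of `Λ_n = box d n` lie in the doubled box `Λ_{2n}`. [folklore] -/
theorem boxPair_sub_mem_box_two_mul {d n : ℕ} {a b : Site d} (ha : a ∈ box d n)
    (hb : b ∈ box d n) : b - a ∈ box d (2 * n) := by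
  rw [mem_box] at ha hb ⊢
  intro i
  have h₁ := ha i
  have h₂ := hb i
  simp only [Pi.sub_apply]
  push_cast
  omega

/-- For a fixed `a ∈ Λ_n`: `Σ_{b ∈ Λ_n} G(b - a) ≤ χ_{2n}` (reindex by the injection `b ↦ b - a`, whose
image lies in `Λ_{2n}`, and use `G ≥ 0`). [folklore] -/
theorem boxPair_sum_sub_le {d n : ℕ} {a : Site d} (ha : a ∈ box d n) :
    ∑ b ∈ box d n, criticalTwoPoint d (b - a) ≤
      ∑ y ∈ box d (2 * n), criticalTwoPoint d y := by
  have hinj : Set.InjOn (fun b : Site d => b - a) ↑(box d n) := sub_left_injective.injOn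
  rw [← Finset.sum_image hinj]
  refine Finset.sum_le_sum_of_subset_of_nonneg ?_ fun y _ _ => criticalTwoPoint_nonneg' y
  intro y hy
  obtain ⟨b, hb, rfl⟩ := Finset.mem_image.1 hy
  exact boxPair_sub_mem_box_two_mul ha hb

/-- The block pair sum is dominated by the box volume times the doubled-box susceptibility:
`B_n = Σ_{a,b ∈ Λ_n} G(b - a) ≤ (2n+1)^d χ_{2n}`. [folklore] -/
theorem boxPair_pairSum_le (d n : ℕ) :
    ∑ a ∈ box d n, ∑ b ∈ box d n, criticalTwoPoint d (b - a) ≤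
      ((2 * n + 1 : ℕ) : ℝ) ^ d * ∑ y ∈ box d (2 * n), criticalTwoPoint d y := by
  calc ∑ a ∈ box d n, ∑ b ∈ box d n, criticalTwoPoint d (b - a)
      ≤ ∑ a ∈ box d n, ∑ y ∈ box d (2 * n), criticalTwoPoint d y :=
        Finset.sum_le_sum fun a ha => boxPair_sum_sub_le ha
    _ = ((2 * n + 1 : ℕ) : ℝ) ^ d * ∑ y ∈ box d (2 * n), criticalTwoPoint d y := by
        rw [Finset.sum_const, nsmul_eq_mul, card_box, Nat.cast_pow]

/-- The box susceptibility `χ_n = Σ_{x ∈ Λ_n} G(x)` is monotone in `n` (`G ≥ 0`, `Λ_n ⊆ Λ_m`).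
[folklore] -/
theorem boxPair_boxSum_mono {d n m : ℕ} (h : n ≤ m) :
    ∑ y ∈ box d n, criticalTwoPoint d y ≤ ∑ y ∈ box d m, criticalTwoPoint d y :=
  Finset.sum_le_sum_of_subset_of_nonneg (box_mono d h) fun y _ _ => criticalTwoPoint_nonneg' y

/-- `χ_n ≥ G(0) = 1` for every box. [folklore] -/
theorem boxPair_one_le_boxSum (d n : ℕ) : 1 ≤ ∑ y ∈ box d n, criticalTwoPoint d y := by
  rw [← criticalTwoPoint_zero' (d := d)]
  exact Finset.single_le_sum (fun y _ => criticalTwoPoint_nonneg' y) (zero_mem_box d n)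

/-! ### The stub -/

/-- **S3 — block pair sum ⇒ box susceptibility (bridge between the two cards).**
`B_n = Σ_{a,b∈Λ_n} G(b-a) ≥ c n^s` (`s ≥ 3`) ⟹ `χ_n ≥ c' n^{3-(6-s)}`: `B_n ≤ |Λ_n| χ_{2n}` since
`b - a ∈ Λ_{2n}`, `|Λ_n| ≤ 27 n³`, and `χ` is monotone in the box (`G ≥ 0`), odd `n` by `χ_n ≥ χ_{n-1}`.
[folklore] -/
theorem stub_susceptibilityFloorOfBoxPairFloor :
    ∀ s : ℝ, 3 ≤ s →
      (∃ c : ℝ, 0 < c ∧ ∀ n : ℕ, 1 ≤ n →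
        c * (n : ℝ) ^ s ≤ ∑ a ∈ box 3 n, ∑ b ∈ box 3 n, criticalTwoPoint 3 (b - a)) →
      ∃ c : ℝ, 0 < c ∧ ∀ n : ℕ, 1 ≤ n →
        c * (n : ℝ) ^ (3 - (6 - s)) ≤ ∑ x ∈ box 3 n, criticalTwoPoint 3 x := by
  intro s hs hB
  obtain ⟨c, hc, hB⟩ := hB
  have h3pow : (0 : ℝ) < (3 : ℝ) ^ (s - 3) := Real.rpow_pos_of_pos (by norm_num) _
  have h27 : (0 : ℝ) < 27 * (3 : ℝ) ^ (s - 3) := by positivity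
  set K : ℝ := c / (27 * (3 : ℝ) ^ (s - 3)) with hK
  have hKpos : 0 < K := div_pos hc h27
  refine ⟨min 1 K, lt_min one_pos hKpos, fun N hN => ?_⟩
  have e : (3 - (6 - s) : ℝ) = s - 3 := by ring
  rw [e]
  rcases Nat.lt_or_ge N 2 with hN2 | hN2
  · -- `N = 1`: `χ_1 ≥ G(0) = 1 ≥ min 1 K`.
    obtain rfl : N = 1 := by omega
    simp only [Nat.cast_one, Real.one_rpow, mul_one]
    exact (min_le_left _ _).trans (boxPair_one_le_boxSum 3 1)
  · -- `N ≥ 2`: compare with the half box `Λ_n`, `n = ⌊N/2⌋`.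
    set n : ℕ := N / 2 with hn
    have hn1 : 1 ≤ n := by omega
    have h2n : 2 * n ≤ N := by omega
    have h3n : N ≤ 3 * n := by omega
    have hnpos : (0 : ℝ) < n := by exact_mod_cast hn1
    have hNreal : (N : ℝ) ≤ 3 * n := by exact_mod_cast h3n
    have hcard : ((2 * n + 1 : ℕ) : ℝ) ^ 3 ≤ 27 * (n : ℝ) ^ (3 : ℕ) := by
      have h : ((2 * n + 1 : ℕ) : ℝ) ≤ 3 * n := by
        exact_mod_cast (show 2 * n + 1 ≤ 3 * n by omega)
      calc ((2 * n + 1 : ℕ) : ℝ) ^ 3 ≤ (3 * (n : ℝ)) ^ 3 := pow_le_pow_left₀ (by positivity) h 3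
        _ = 27 * (n : ℝ) ^ 3 := by ring
    have hchiN : 0 ≤ ∑ x ∈ box 3 N, criticalTwoPoint 3 x :=
      Finset.sum_nonneg fun x _ => criticalTwoPoint_nonneg' x
    have hchain : c * (n : ℝ) ^ s ≤ 27 * (n : ℝ) ^ (3 : ℕ) * ∑ x ∈ box 3 N, criticalTwoPoint 3 x :=
      calc c * (n : ℝ) ^ s ≤ ∑ a ∈ box 3 n, ∑ b ∈ box 3 n, criticalTwoPoint 3 (b - a) := hB n hn1
        _ ≤ ((2 * n + 1 : ℕ) : ℝ) ^ 3 * ∑ y ∈ box 3 (2 * n), criticalTwoPoint 3 y :=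
          boxPair_pairSum_le 3 n
        _ ≤ ((2 * n + 1 : ℕ) : ℝ) ^ 3 * ∑ x ∈ box 3 N, criticalTwoPoint 3 x :=
          mul_le_mul_of_nonneg_left (boxPair_boxSum_mono h2n) (by positivity)
        _ ≤ 27 * (n : ℝ) ^ (3 : ℕ) * ∑ x ∈ box 3 N, criticalTwoPoint 3 x :=
          mul_le_mul_of_nonneg_right hcard hchiN
    have hsplit : (n : ℝ) ^ s = (n : ℝ) ^ (s - 3) * (n : ℝ) ^ (3 : ℕ) := by
      rw [← Real.rpow_natCast, ← Real.rpow_add hnpos]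
      norm_num
    have key : c * (n : ℝ) ^ (s - 3) ≤ 27 * ∑ x ∈ box 3 N, criticalTwoPoint 3 x := by
      have hn3 : (0 : ℝ) < (n : ℝ) ^ (3 : ℕ) := by positivity
      refine le_of_mul_le_mul_right ?_ hn3
      calc c * (n : ℝ) ^ (s - 3) * (n : ℝ) ^ (3 : ℕ) = c * (n : ℝ) ^ s := by rw [hsplit, mul_assoc]
        _ ≤ 27 * (n : ℝ) ^ (3 : ℕ) * ∑ x ∈ box 3 N, criticalTwoPoint 3 x := hchain
        _ = 27 * (∑ x ∈ box 3 N, criticalTwoPoint 3 x) * (n : ℝ) ^ (3 : ℕ) := by ring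
    have hNpow : (N : ℝ) ^ (s - 3) ≤ (3 : ℝ) ^ (s - 3) * (n : ℝ) ^ (s - 3) := by
      rw [← Real.mul_rpow (by norm_num) hnpos.le]
      exact Real.rpow_le_rpow (Nat.cast_nonneg N) hNreal (sub_nonneg.2 hs)
    have hfin : K * (N : ℝ) ^ (s - 3) ≤ ∑ x ∈ box 3 N, criticalTwoPoint 3 x := by
      rw [hK, div_mul_eq_mul_div, div_le_iff₀ h27]
      calc c * (N : ℝ) ^ (s - 3) ≤ c * ((3 : ℝ) ^ (s - 3) * (n : ℝ) ^ (s - 3)) :=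
            mul_le_mul_of_nonneg_left hNpow hc.le
        _ = (3 : ℝ) ^ (s - 3) * (c * (n : ℝ) ^ (s - 3)) := by ring
        _ ≤ (3 : ℝ) ^ (s - 3) * (27 * ∑ x ∈ box 3 N, criticalTwoPoint 3 x) :=
            mul_le_mul_of_nonneg_left key h3pow.le
        _ = (∑ x ∈ box 3 N, criticalTwoPoint 3 x) * (27 * (3 : ℝ) ^ (s - 3)) := by ring
    calc min 1 K * (N : ℝ) ^ (s - 3) ≤ K * (N : ℝ) ^ (s - 3) :=
          mul_le_mul_of_nonneg_right (min_le_right _ _) (Real.rpow_nonneg (Nat.cast_nonneg N) _)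
      _ ≤ ∑ x ∈ box 3 N, criticalTwoPoint 3 x := hfin

end Summit.CriticalPhenomena.Ising3DConformalLimit.SubPtolemyFloorSketch

end
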